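import Literature.MathematicalPhysics.QuantumFieldTheory.Balaban1983to89.B1Eq324BenfattoKernelSect5StepBound
import Literature.MathematicalPhysics.QuantumFieldTheory.Balaban1983to89.B1Eq324BenfattoKernelSect5PartFieldRows
import Literature.MathematicalPhysics.QuantumFieldTheory.Balaban1983to89.B1Eq324BenfattoKernelSect5ClassRows
import HarnessLib

/-!
# `Balaban1983to89.B1Eq324BenfattoKernelSect5ClassLowerStep` — [BenfattoEtAl1978] §5 pp. 155–159: ONE LOWER PAVEMENT STEP OF THE CLASS ROAD WITH
# THE DEPTH ROWS DISCHARGED FROM THE CLASS CONSTANTS, standard position — the per-step input of the class pavement chain (`hbox`) and of the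
# collection of errors (`hE`), produced from the class rows of [Balaban1985BackgroundPropagators] Sect. E only

statement-level skeleton of published theorems with citation tags; proofs where landed; nothing here is a claim about the
Yang–Mills mass gap

WHY THIS MODULE (cell `pub-ymgap`, seat `dag-n08-c` gen 31; node N08 [Balaban1985UV3]; the [BenfattoEtAl1978] source chain behind the (α)-row `h324`;
the ASSEMBLY layer over seat n08-d's class chain `…KernelSect5PavementChain.lowerPavementChain(_appendixA)` (p617701) — structural S8 of
`N08-PORT-MAP-STRUCTURAL-SIDE.md`).  My `…KernelSect5StepBound.exists_lower_step` produces, at ONE class member `(Λ, A, K)` in standard position, per-box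
exponents `ℓ(□)` with (hbox) the per-box lower bounds in SET-INTEGRAL currency and (hE) the identification inequality with CLOSED errors — under the
DISPLAYED depth rows (a)–(f) (`|Kb|, |K| ≤ K₀`; `ℓ¹` decay at rate `δ₀`; the centre `≤ Kᵤ` on `I`; `≤ ε₃₁` and `|Kb − K| ≤ ε₃₁` at depth; `Kb(x,x) ≤ ½`,
`|u| ≤ ½b(1 + d(Δ_x, I))`).  Seat n08-w5's `…KernelSect5PartFieldRows` (p617346) discharges every one of these rows from the CLASS CONSTANTS — `A` symmetric
`γ_A`-coercive, Euclidean Combes–Thomas row `J_c < γ_A` at rate `θ`, growth rows `V`, `M`, the half- and quarter-rate rows `V₂`, `M₂`, `V₄` — and two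
displayed smallness conditions (`1/γ_A ≤ ½`, `(VM/(γ_A − J_c))·γ ≤ ½`).  This file composes the two: ONE LOWER STEP FROM THE CLASS ROWS, the
constants `Kᵤ, K₀, ε₃₁, δ` kept as letters tied to the class constants by displayed inequalities (`(1 + VM/(γ_A−J_c))γb ≤ Kᵤ ≤ K₀`,
`1/(γ_A−J_c) ≤ K₀`, `1 ≤ K₀`, the two depth budgets `≤ ε₃₁`, `δ ≤ θ/√d`), the error `Err(□)` SUBSTITUTED by its closed form.  The sequel
`…KernelSect5ClassLowerStepFrame` transports it to the frame-`σ` class member `(Λ − σ, A(·+σ,·+σ), K(·+σ,·+σ))` and the translated datum — literally the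
step-`k` hypotheses of `lowerPavementChain` (`hbox`) and of my `…KernelSect5CollectErrors.exp_cumulantSum_sub_le_integral_of_chain` (`hE`).

DICTIONARY.  `B = (J + τ).image boxIndex` (the tesserae meeting the translated support), `Γ₁ = corridors L w B`, `u_{Γ₁}(ξ) = condMean K Γ₁ ξ`,
`N^K_{□,ξ} = 𝒩(u_{Γ₁}(ξ), Kb □)`; the Euclidean weight `|x − y|₂ = √(Σ_j(x_j − y_j)²)` is the `dist` of n08-w5's rows (`hl2` by `le_rfl`).

WHAT IS PROVED (theorems only; no definition, no named fact, no `sorry`; axioms standard).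
* §1 ★★ `exists_lower_step_of_classRows` — ∃ `ℓ`: (hbox, set-integral currency) ∧ (hE, closed), at a class member in standard position, every depth row
  discharged from the class rows (`Λ ≠ ∅`).  (The frame-`σ` edition, (hbox) in the chain's two-indicator currency, is `…KernelSect5ClassLowerStepFrame`.)

HONEST SCOPE / NOT HERE.  The chain over `d + 1` steps, the Appendix-A end and the ledger are the knit (`…KernelSect5LowerAssembly`, next); the class and
its rows are OURS ([Balaban1985BackgroundPropagators] Sect. E read at temperature zero), not print's `P̂₀`; one self-located piece of an UNCOMMISSIONED
port (plan g81 (II), START-LIST v11 §n08) — nothing chained; no generalised Basic Lemma is stated; nothing of [Balaban1985UV3] is asserted; count-neutral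
for N08; nothing about d = 4, the continuum, OS axioms, a mass gap or the Clay problem.
-/

noncomputable section

open MeasureTheory ProbabilityTheory Finset Matrix
open scoped BigOperators Nat NNReal

namespace Literature.MathematicalPhysics.QuantumFieldTheory.Balaban1983to89.B1Eq324BenfattoKernelSect5ClassLowerStep

open _root_.MeasureTheory _root_.ProbabilityTheory
open Literature.Probability.LatticeModels (setPartitions)
open Literature.MathematicalPhysics.QuantumFieldTheory
open Literature.MathematicalPhysics.QuantumFieldTheory.Balaban1983to89.B1Eq324BenfattoLemma
open Literature.MathematicalPhysics.QuantumFieldTheory.Balaban1983to89.B1Eq324BenfattoSect5Boxes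
open Literature.MathematicalPhysics.QuantumFieldTheory.Balaban1983to89.B1Eq324BenfattoSect5Eq511
open Literature.MathematicalPhysics.QuantumFieldTheory.Balaban1983to89.B1Eq324BenfattoSect5Eq524
open Literature.MathematicalPhysics.QuantumFieldTheory.Balaban1983to89.B1Eq324BenfattoSect5Eq534
open Literature.MathematicalPhysics.QuantumFieldTheory.Balaban1983to89.B1Eq324BenfattoSect5Eq515
open Literature.MathematicalPhysics.QuantumFieldTheory.Balaban1983to89.B1Eq324BenfattoSect5Iteration (restrictCoef shiftCoef)
open Literature.MathematicalPhysics.QuantumFieldTheory.Balaban1983to89.B1Eq324BenfattoClassAppendixC (posDef_of_coercive)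
open Literature.MathematicalPhysics.QuantumFieldTheory.Balaban1983to89.B1Eq324BenfattoKernelSect5StepBound (exists_lower_step)
open Literature.MathematicalPhysics.QuantumFieldTheory.Balaban1983to89.B1Eq324BenfattoKernelSect5PartFieldRows
open Literature.MathematicalPhysics.QuantumFieldTheory.Balaban1983to89.B1Eq324BenfattoKernelSect5ClassRows (l2_self l2_comm l2_triangle)
open Literature.MathematicalPhysics.QuantumFieldTheory.Balaban1983to89.B1Eq324GaussianMomentLeaf (momentConst)

variable {d : ℕ}

/-! ## §0  A kernel: a displayed row constant is non-negative -/

/-- kernel: a row bound of a non-negative weight over a non-empty index set is non-negative. [folklore] -/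
private theorem const_nonneg_of_row {Λ : Finset (B1Eq324BenfattoLemma.Site d)} (hΛ : Λ.Nonempty) {f : ↥Λ → ↥Λ → ℝ} {C : ℝ}
    (hf : ∀ e e', 0 ≤ f e e') (hC : ∀ e : Λ, ∑ e' : Λ, f e e' ≤ C) : 0 ≤ C := by
  obtain ⟨x, hx⟩ := hΛ
  exact le_trans (Finset.sum_nonneg fun e' _ => hf ⟨x, hx⟩ e') (hC ⟨x, hx⟩)


/-! ## §1  One lower step from the class rows, standard position -/

section Standard

variable {Λ : Finset (B1Eq324BenfattoLemma.Site d)} {A : Matrix Λ Λ ℝ}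
  {K : B1Eq324BenfattoLemma.Site d → B1Eq324BenfattoLemma.Site d → ℝ}
  (hK : ∀ x y, K x y = if h : x ∈ Λ ∧ y ∈ Λ then (A⁻¹ : Matrix Λ Λ ℝ) ⟨x, h.1⟩ ⟨y, h.2⟩ else 0)
  {s D : ℕ} {κ : ℝ} {a : Coef d} {J I : Finset (B1Eq324BenfattoLemma.Site d)} {L w v : ℕ} {γ b Ac : ℝ}
  (hBΛ : ∀ m ∈ (J.image (boxIndex L)), box L m ⊆ Λ)
  {Kb : B1Eq324BenfattoLemma.Site d → B1Eq324BenfattoLemma.Site d → B1Eq324BenfattoLemma.Site d → ℝ}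
  (hKb : ∀ m (hm : m ∈ (J.image (boxIndex L))) x y, Kb m x y = if h : x ∈ shrink L m w ∧ y ∈ shrink L m w then
    ((A.submatrix (fun j : ↥(shrink L m w) => (⟨j, hBΛ m hm (shrink_subset_box L m w j.2)⟩ : Λ))
      (fun j : ↥(shrink L m w) => (⟨j, hBΛ m hm (shrink_subset_box L m w j.2)⟩ : Λ)))⁻¹ :
        Matrix ↥(shrink L m w) ↥(shrink L m w) ℝ) ⟨x, h.1⟩ ⟨y, h.2⟩ else 0)

include hK hKb

/-- ★★ **ONE LOWER STEP OF THE CLASS ROAD FROM THE CLASS ROWS, STANDARD POSITION.**  At a class member `(Λ, A, K)` (`Λ ≠ ∅`; `A` symmetric and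
`γ_A`-coercive; Euclidean Combes–Thomas row `J_c < γ_A` at rate `θ > 0`; growth rows `V`, `M`; half-rate rows `V₂`, `M₂`; quarter-rate growth row `V₄`)
carrying a standard-position datum (`A` supported in `J ⊆ I`, `|A| ≤ A_c`, cut-off `b ≥ 1`, contraction `0 ≤ γ ≤ 1`), print's pavement
(`2(2w+v) < L`, `v ≤ w`, (5.19)'s `L^d e^{−b²/4} ≤ 1/6`) with `B = J.image boxIndex`, corridors and boxes inside `Λ`, the definitional part-kernel row, and
letters `Kᵤ ≤ K₀`, `ε₃₁`, `δ` tied to the class constants by `(1 + VM/(γ_A−J_c))γb ≤ Kᵤ`, `1/(γ_A−J_c) ≤ K₀`, `1 ≤ K₀`, the two depth budgets `≤ ε₃₁`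
((5.30)–(5.31) at depth `w − v`), `1/γ_A ≤ ½`, `(VM/(γ_A−J_c))γ ≤ ½`, `0 < δ ≤ θ/√d` below the Hamiltonian's rate: THERE ARE per-box exponents `ℓ(□)` with
(hbox) `e^{ℓ(□)}·∫_{χ^□_b}e^{Ψ′₁+Ψ₂}dN^K_{□,ξ} ≤ ∫_{χ^□_b}e^{Ψ_□}dN^K_{□,ξ}` for every `□ ∈ B` and every `ξ` small on `Γ₁` at `γb`, and (hE)
`cumulantSum μ_K H_J t − cumulantSum μ_K H_{Γ̄₁} t − (Σ_□Err(□) + CUMB) ≤ Σ_□ℓ(□)` with `Err(□)` and `CUMB` CLOSED — `…KernelSect5StepBound.exists_lower_step`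
with rows (a)–(f) discharged BY NAME from `…KernelSect5PartFieldRows` (`abs_partKernel_le`, `abs_kernel_le`, `abs_partKernel_le_exp_l1`,
`abs_condMean_le_on_region`, `abs_condMean_le_deep_of_le`, `abs_partKernel_sub_kernel_le_of_le`, `partKernel_self_le_half`,
`abs_condMean_le_half_profile_on_shrink`, and (b′) for `K` itself `abs_kernel_le_exp_l1` — v1.1, p618933).
[cite: BenfattoEtAl1978, §5 (5.16)–(5.35) pp.155–159, (4.7) p.152, Appendix C pp.164–165 (class form); Balaban1985BackgroundPropagators, (1.16)–(1.18) p.180] -/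
theorem exists_lower_step_of_classRows (hΛ : Λ.Nonempty)
    (hAs : ∀ e e', A e e' = A e' e) {γA : ℝ} (hγA0 : 0 < γA)
    (hγA : ∀ x : Λ → ℝ, γA * ∑ e, x e ^ 2 ≤ ∑ e, ∑ e', A e e' * x e * x e')
    {θ Jc V M V₂ M₂ V₄ : ℝ} (hθ : 0 < θ)
    (hJc : ∀ e : Λ, ∑ e' : Λ, |A e e'| * (Real.cosh (θ * Real.sqrt (∑ j, ((((e : B1Eq324BenfattoLemma.Site d) j : ℝ) - ((e' : B1Eq324BenfattoLemma.Site d) j : ℝ))) ^ 2)) - 1) ≤ Jc)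
    (hJcγ : Jc < γA)
    (hV : ∀ e : Λ, ∑ e' : Λ, Real.exp (-(θ * Real.sqrt (∑ j, ((((e : B1Eq324BenfattoLemma.Site d) j : ℝ) - ((e' : B1Eq324BenfattoLemma.Site d) j : ℝ))) ^ 2))) *
      (1 + Real.sqrt (∑ j, ((((e : B1Eq324BenfattoLemma.Site d) j : ℝ) - ((e' : B1Eq324BenfattoLemma.Site d) j : ℝ))) ^ 2)) ≤ V)
    (hM : ∀ e : Λ, ∑ e' : Λ, |A e e'| * (1 + Real.sqrt (∑ j, ((((e : B1Eq324BenfattoLemma.Site d) j : ℝ) - ((e' : B1Eq324BenfattoLemma.Site d) j : ℝ))) ^ 2)) ≤ M)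
    (hV₂ : ∀ e : Λ, ∑ e' : Λ, Real.exp (-(θ / 2 * Real.sqrt (∑ j, ((((e : B1Eq324BenfattoLemma.Site d) j : ℝ) - ((e' : B1Eq324BenfattoLemma.Site d) j : ℝ))) ^ 2))) ≤ V₂)
    (hM₂ : ∀ e : Λ, ∑ e' : Λ, |A e e'| * Real.exp (θ / 2 * Real.sqrt (∑ j, ((((e : B1Eq324BenfattoLemma.Site d) j : ℝ) - ((e' : B1Eq324BenfattoLemma.Site d) j : ℝ))) ^ 2)) ≤ M₂)
    (hV₄ : ∀ e : Λ, ∑ e' : Λ, Real.exp (-(θ / 4 * Real.sqrt (∑ j, ((((e : B1Eq324BenfattoLemma.Site d) j : ℝ) - ((e' : B1Eq324BenfattoLemma.Site d) j : ℝ))) ^ 2))) *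
      (1 + Real.sqrt (∑ j, ((((e : B1Eq324BenfattoLemma.Site d) j : ℝ) - ((e' : B1Eq324BenfattoLemma.Site d) j : ℝ))) ^ 2)) ≤ V₄)
    (hκ : 0 < κ) (hJ : CoefSupportedIn a J) (hJI : J ⊆ I) (hAc0 : 0 ≤ Ac)
    (hA : ∀ (p : ℕ) (Δ : Fin p → B1Eq324BenfattoLemma.Site d) (n : Fin p → ℕ), |a p Δ n| ≤ Ac)
    (hL2 : 2 * (2 * w + v) < L) (hv : v ≤ w) (hb : 1 ≤ b) (hγ0 : 0 ≤ γ) (hγ1 : γ ≤ 1)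
    (hsmall : ((L : ℝ) ^ d) * Real.exp (-(b ^ 2 / 4)) ≤ 1 / 6)
    (hΓΛ : corridors L w (J.image (boxIndex L)) ⊆ Λ)
    {Ku K₀ ε₃₁ : ℝ} (hKuI : (1 + V * M / (γA - Jc)) * (γ * b) ≤ Ku) (hKuK : Ku ≤ K₀) (hK₀ : 1 / (γA - Jc) ≤ K₀) (hK₀1 : 1 ≤ K₀)
    (hε₁ : V₂ * M₂ / (γA - Jc) ^ 2 * Real.exp (-(θ / 2 * ((w - v : ℕ) : ℝ))) + Real.exp (-(θ * ((w - v : ℕ) : ℝ))) / (γA - Jc) ≤ ε₃₁)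
    (hε₂ : M₂ / (γA - Jc) * (γ * b) * (1 + Real.sqrt d * ((L : ℝ) - 1)) * V₄ * Real.exp (-(θ / 4 * ((w - v : ℕ) : ℝ))) ≤ ε₃₁)
    (hhalf : 1 / γA ≤ 1 / 2) (hsmallγ : V * M / (γA - Jc) * γ ≤ 1 / 2)
    {δ : ℝ} (hδ : 0 < δ) (hδle : δ ≤ θ / Real.sqrt d) (hres : 0 < κ / 2 - δ / 2 * ((D : ℝ) ^ 2 * Real.sqrt d)) (t : ℕ) :
    ∃ ℓ : B1Eq324BenfattoLemma.Site d → ℝ,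
      (∀ m ∈ (J.image (boxIndex L)), ∀ ξ : B1Eq324BenfattoLemma.Site d → ℝ,
        ξ ∈ smallFieldOn (corridors L w (J.image (boxIndex L)) : Set (B1Eq324BenfattoLemma.Site d)) I (γ * b) →
        Real.exp (ℓ m) * ∫ z in smallFieldOn (shrink L m w : Set (B1Eq324BenfattoLemma.Site d)) I b,
            Real.exp (psi1p s D κ a L w v m z + psi2 s D κ a L w m z) ∂((gaussianFieldOfKernel (Kb m)).map
              fun (ζ : B1Eq324BenfattoLemma.Site d → ℝ) (x : B1Eq324BenfattoLemma.Site d) => condMean K (corridors L w (J.image (boxIndex L))) ξ x + ζ x)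
          ≤ ∫ z in smallFieldOn (shrink L m w : Set (B1Eq324BenfattoLemma.Site d)) I b,
            Real.exp (psiBox s D κ a L w m z) ∂((gaussianFieldOfKernel (Kb m)).map
              fun (ζ : B1Eq324BenfattoLemma.Site d → ℝ) (x : B1Eq324BenfattoLemma.Site d) => condMean K (corridors L w (J.image (boxIndex L))) ξ x + ζ x)) ∧
      ((cumulantSum (gaussianFieldOfKernel K) (hamiltonian s D κ a J) t - cumulantSum (gaussianFieldOfKernel K) (hamiltonian s D κ a (corridorsBar L w v (J.image (boxIndex L)))) t)
          - (∑ m ∈ (J.image (boxIndex L)),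
              (2 * (2 ^ ((t + 1).choose 2) * (4 * (s1Const s D d κ * Ac * b ^ D * (L : ℝ) ^ d)) ^ (t + 1) / (t + 1)!) +
                    Real.exp (2 * (4 * (s1Const s D d κ * Ac * b ^ D * (L : ℝ) ^ d))) *
                      (3 * (((shrink L m w).card : ℝ) * Real.exp (-(b ^ 2 / 4)))) +
                    ∑ k ∈ Finset.range t,
                      (3 ^ (k + 1) * ((∑ π ∈ setPartitions (univ : Finset (Fin (k + 1))), ((π.card - 1)! : ℝ)) *
                          (s1Const s D d κ * Ac * b ^ D * Real.exp (-(κ / 4 * v)) * (L : ℝ) ^ d *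
                            (4 * (s1Const s D d κ * Ac * b ^ D * (L : ℝ) ^ d)) ^ k)) +
                        3 ^ (k + 1) * (2 ^ (k + 1) * ((∑ π ∈ setPartitions (univ : Finset (Fin (k + 1))), ((π.card - 1)! : ℝ)) *
                            ((min 1 (2 * ((shrink L m w).card : ℝ) * Real.exp (-(b ^ 2 / 4)))) ^ ((2 * (k + 1) : ℕ) : ℝ)⁻¹ *
                              ((1 + Ku) ^ D * (Ac * (L : ℝ) ^ d * ∑ p ∈ Finset.Icc 1 s, ((admissible p D).card : ℝ) *
              ((2 / (1 - Real.exp (-(κ / 2 / (p : ℕ) / Real.sqrt d))) * Real.exp (κ / 2 / (p : ℕ) / Real.sqrt d)) ^ d) ^ (p - 1)) * momentConst D (2 * (k + 1)) K₀.toNNReal) ^ (k + 1))) +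
                          2 ^ ((k + 1) * D) * 2 ^ 2 ^ ((k + 1) * D) * K₀ ^ ((k + 1) * D) * Real.exp (-(δ / 2 * ((v : ℝ) + 1))) *
                            (Ac * Real.exp (δ / 2 * ((D : ℝ) ^ 2 * d)) * (L : ℝ) ^ d * ∑ p ∈ Finset.Icc 1 s, ((admissible p D).card : ℝ) *
              ((2 / (1 - Real.exp (-((κ / 2 - δ / 2 * ((D : ℝ) ^ 2 * Real.sqrt d)) / (p : ℕ) / Real.sqrt d))) *
                Real.exp ((κ / 2 - δ / 2 * ((D : ℝ) ^ 2 * Real.sqrt d)) / (p : ℕ) / Real.sqrt d)) ^ d) ^ (p - 1)) ^ (k + 1)) +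
                        3 ^ (k + 1) * (2 ^ (k + 1) * ((∑ π ∈ setPartitions (univ : Finset (Fin (k + 1))), ((π.card - 1)! : ℝ)) *
                            ((min 1 (2 * ((shrink L m w).card : ℝ) * Real.exp (-(b ^ 2 / 4)))) ^ ((2 * (k + 1) : ℕ) : ℝ)⁻¹ *
                              ((1 + Ku) ^ D * (Ac * (L : ℝ) ^ d * ∑ p ∈ Finset.Icc 1 s, ((admissible p D).card : ℝ) *
              ((2 / (1 - Real.exp (-(κ / 2 / (p : ℕ) / Real.sqrt d))) * Real.exp (κ / 2 / (p : ℕ) / Real.sqrt d)) ^ d) ^ (p - 1)) * momentConst D (2 * (k + 1)) K₀.toNNReal) ^ (k + 1))) +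
                          (Ac * (L : ℝ) ^ d * ∑ p ∈ Finset.Icc 1 s, ((admissible p D).card : ℝ) *
              ((2 / (1 - Real.exp (-(κ / 2 / (p : ℕ) / Real.sqrt d))) * Real.exp (κ / 2 / (p : ℕ) / Real.sqrt d)) ^ d) ^ (p - 1)) ^ (k + 1) * (2 ^ ((k + 1) * D) * 2 ^ 2 ^ ((k + 1) * D) *
                            ((((k + 1) * D : ℕ) : ℝ) * K₀ ^ ((k + 1) * D) * ε₃₁)))) / (k + 1)!) +
            ∑ k ∈ Finset.range t,
          ((2 ^ (k + 1) * (2 ^ ((k + 1) * D) * 2 ^ 2 ^ ((k + 1) * D) * K₀ ^ ((k + 1) * D)) *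
          ((Ac * Real.exp (δ / 2 * ((D : ℝ) ^ 2 * d)) *
              Real.exp (-((κ / 2 - δ / 2 * ((D : ℝ) ^ 2 * Real.sqrt d)) / 2 * w))) * J.card *
            ∑ p ∈ Finset.Icc 1 s, ((admissible p D).card : ℝ) *
              ((2 / (1 - Real.exp (-((κ / 2 - δ / 2 * ((D : ℝ) ^ 2 * Real.sqrt d)) / 2 / (p : ℕ) / Real.sqrt d))) *
                Real.exp ((κ / 2 - δ / 2 * ((D : ℝ) ^ 2 * Real.sqrt d)) / 2 / (p : ℕ) / Real.sqrt d)) ^ d) ^ (p - 1)) *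
          (Ac * Real.exp (δ / 2 * ((D : ℝ) ^ 2 * d)) *
            ((1 : ℝ) * (2 / (1 - Real.exp (-(δ / (2 * ((k + 1 : ℕ) : ℝ)) / Real.sqrt d))) * Real.exp (δ / (2 * ((k + 1 : ℕ) : ℝ)) / Real.sqrt d)) ^ d) *
            ∑ p ∈ Finset.Icc 1 s, ((admissible p D).card : ℝ) *
              ((2 / (1 - Real.exp (-((κ / 2 - δ / 2 * ((D : ℝ) ^ 2 * Real.sqrt d)) / (p : ℕ) / Real.sqrt d))) *
                Real.exp ((κ / 2 - δ / 2 * ((D : ℝ) ^ 2 * Real.sqrt d)) / (p : ℕ) / Real.sqrt d)) ^ d) ^ (p - 1)) ^ k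
          + 2 ^ (k + 1) * (2 ^ ((k + 1) * D) * 2 ^ 2 ^ ((k + 1) * D) * K₀ ^ ((k + 1) * D)) *
        ((J.image (boxIndex L)).card * (Ac * Real.exp (δ / 2 * ((D : ℝ) ^ 2 * d)) * Real.exp (-((κ / 2 - δ / 2 * ((D : ℝ) ^ 2 * Real.sqrt d)) / 2 * v)) *
          (L : ℝ) ^ d * ∑ p ∈ Finset.Icc 1 s, ((admissible p D).card : ℝ) *
              ((2 / (1 - Real.exp (-((κ / 2 - δ / 2 * ((D : ℝ) ^ 2 * Real.sqrt d)) / 2 / (p : ℕ) / Real.sqrt d))) *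
                Real.exp ((κ / 2 - δ / 2 * ((D : ℝ) ^ 2 * Real.sqrt d)) / 2 / (p : ℕ) / Real.sqrt d)) ^ d) ^ (p - 1))) *
        (Ac * Real.exp (δ / 2 * ((D : ℝ) ^ 2 * d)) *
          (2 / (1 - Real.exp (-(δ / (2 * ((k + 1 : ℕ) : ℝ)) / Real.sqrt d))) * Real.exp (δ / (2 * ((k + 1 : ℕ) : ℝ)) / Real.sqrt d)) ^ d *
          ∑ p ∈ Finset.Icc 1 s, ((admissible p D).card : ℝ) *
              ((2 / (1 - Real.exp (-((κ / 2 - δ / 2 * ((D : ℝ) ^ 2 * Real.sqrt d)) / (p : ℕ) / Real.sqrt d))) *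
                Real.exp ((κ / 2 - δ / 2 * ((D : ℝ) ^ 2 * Real.sqrt d)) / (p : ℕ) / Real.sqrt d)) ^ d) ^ (p - 1)) ^ k)
          + (2 ^ (k + 1) * (2 ^ ((k + 1) * D) * 2 ^ 2 ^ ((k + 1) * D) * K₀ ^ ((k + 1) * D)) *
          (Ac * Real.exp (δ / 2 * ((D : ℝ) ^ 2 * d)) * Real.exp (-((κ / 2 - δ / 2 * ((D : ℝ) ^ 2 * Real.sqrt d)) / 2 * w)) *
            (corridorsBar L w v (J.image (boxIndex L))).card * ∑ p ∈ Finset.Icc 1 s, ((admissible p D).card : ℝ) *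
              ((2 / (1 - Real.exp (-((κ / 2 - δ / 2 * ((D : ℝ) ^ 2 * Real.sqrt d)) / 2 / (p : ℕ) / Real.sqrt d))) *
                Real.exp ((κ / 2 - δ / 2 * ((D : ℝ) ^ 2 * Real.sqrt d)) / 2 / (p : ℕ) / Real.sqrt d)) ^ d) ^ (p - 1)) *
          (Ac * Real.exp (δ / 2 * ((D : ℝ) ^ 2 * d)) *
            (2 / (1 - Real.exp (-(δ / (2 * ((k + 1 : ℕ) : ℝ)) / Real.sqrt d))) * Real.exp (δ / (2 * ((k + 1 : ℕ) : ℝ)) / Real.sqrt d)) ^ d *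
            ∑ p ∈ Finset.Icc 1 s, ((admissible p D).card : ℝ) *
              ((2 / (1 - Real.exp (-((κ / 2 - δ / 2 * ((D : ℝ) ^ 2 * Real.sqrt d)) / (p : ℕ) / Real.sqrt d))) *
                Real.exp ((κ / 2 - δ / 2 * ((D : ℝ) ^ 2 * Real.sqrt d)) / (p : ℕ) / Real.sqrt d)) ^ d) ^ (p - 1)) ^ k
          + 2 ^ (k + 1) * (2 ^ ((k + 1) * D) * 2 ^ 2 ^ ((k + 1) * D) * K₀ ^ ((k + 1) * D)) *
        ((J.image (boxIndex L)).card * (Ac * Real.exp (δ / 2 * ((D : ℝ) ^ 2 * d)) * Real.exp (-((κ / 2 - δ / 2 * ((D : ℝ) ^ 2 * Real.sqrt d)) / 2 * v)) *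
          (L : ℝ) ^ d * ∑ p ∈ Finset.Icc 1 s, ((admissible p D).card : ℝ) *
              ((2 / (1 - Real.exp (-((κ / 2 - δ / 2 * ((D : ℝ) ^ 2 * Real.sqrt d)) / 2 / (p : ℕ) / Real.sqrt d))) *
                Real.exp ((κ / 2 - δ / 2 * ((D : ℝ) ^ 2 * Real.sqrt d)) / 2 / (p : ℕ) / Real.sqrt d)) ^ d) ^ (p - 1))) *
        (Ac * Real.exp (δ / 2 * ((D : ℝ) ^ 2 * d)) *
          (2 / (1 - Real.exp (-(δ / (2 * ((k + 1 : ℕ) : ℝ)) / Real.sqrt d))) * Real.exp (δ / (2 * ((k + 1 : ℕ) : ℝ)) / Real.sqrt d)) ^ d *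
          ∑ p ∈ Finset.Icc 1 s, ((admissible p D).card : ℝ) *
              ((2 / (1 - Real.exp (-((κ / 2 - δ / 2 * ((D : ℝ) ^ 2 * Real.sqrt d)) / (p : ℕ) / Real.sqrt d))) *
                Real.exp ((κ / 2 - δ / 2 * ((D : ℝ) ^ 2 * Real.sqrt d)) / (p : ℕ) / Real.sqrt d)) ^ d) ^ (p - 1)) ^ k)
          + 2 ^ ((k + 1) * D) * 2 ^ 2 ^ ((k + 1) * D) * K₀ ^ ((k + 1) * D) *
        ((J.image (boxIndex L)).card * (((k + 1 : ℕ) : ℝ) * (k : ℝ) *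
          ((Ac * Real.exp (δ / 2 * ((D : ℝ) ^ 2 * d)) * ((L : ℝ) ^ d * (2 / (1 - Real.exp (-(δ / (2 * ((k + 1 : ℕ) : ℝ)) / Real.sqrt d))) * Real.exp (δ / (2 * ((k + 1 : ℕ) : ℝ)) / Real.sqrt d)) ^ d) *
              ∑ p ∈ Finset.Icc 1 s, ((admissible p D).card : ℝ) *
              ((2 / (1 - Real.exp (-((κ / 2 - δ / 2 * ((D : ℝ) ^ 2 * Real.sqrt d)) / (p : ℕ) / Real.sqrt d))) *
                Real.exp ((κ / 2 - δ / 2 * ((D : ℝ) ^ 2 * Real.sqrt d)) / (p : ℕ) / Real.sqrt d)) ^ d) ^ (p - 1)) * ((Ac * Real.exp (δ / 2 * ((D : ℝ) ^ 2 * d)) * Real.exp (-(δ / (2 * ((k + 1 : ℕ) : ℝ)) / 2 * ((w : ℝ) + v + 1))) * ((L : ℝ) ^ d * (2 / (1 - Real.exp (-(δ / (2 * ((k + 1 : ℕ) : ℝ)) / 2 / Real.sqrt d))) * Real.exp (δ / (2 * ((k + 1 : ℕ) : ℝ)) / 2 / Real.sqrt d)) ^ d) *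
              ∑ p ∈ Finset.Icc 1 s, ((admissible p D).card : ℝ) *
              ((2 / (1 - Real.exp (-((κ / 2 - δ / 2 * ((D : ℝ) ^ 2 * Real.sqrt d)) / (p : ℕ) / Real.sqrt d))) *
                Real.exp ((κ / 2 - δ / 2 * ((D : ℝ) ^ 2 * Real.sqrt d)) / (p : ℕ) / Real.sqrt d)) ^ d) ^ (p - 1)) *
             (Ac * Real.exp (δ / 2 * ((D : ℝ) ^ 2 * d)) * ((L : ℝ) ^ d * (2 / (1 - Real.exp (-(δ / (2 * ((k + 1 : ℕ) : ℝ)) / Real.sqrt d))) * Real.exp (δ / (2 * ((k + 1 : ℕ) : ℝ)) / Real.sqrt d)) ^ d) *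
              ∑ p ∈ Finset.Icc 1 s, ((admissible p D).card : ℝ) *
              ((2 / (1 - Real.exp (-((κ / 2 - δ / 2 * ((D : ℝ) ^ 2 * Real.sqrt d)) / (p : ℕ) / Real.sqrt d))) *
                Real.exp ((κ / 2 - δ / 2 * ((D : ℝ) ^ 2 * Real.sqrt d)) / (p : ℕ) / Real.sqrt d)) ^ d) ^ (p - 1)) ^ (k - 1)))))
          + (J.image (boxIndex L)).card * ((3 : ℝ) ^ (k + 1) *
        (2 ^ ((k + 1) * D) * 2 ^ 2 ^ ((k + 1) * D) * K₀ ^ ((k + 1) * D) *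
            Real.exp (-(δ / 2 * ((v : ℝ) + 1))) *
          (Ac * Real.exp (δ / 2 * ((D : ℝ) ^ 2 * d)) * (L : ℝ) ^ d * ∑ p ∈ Finset.Icc 1 s, ((admissible p D).card : ℝ) *
              ((2 / (1 - Real.exp (-((κ / 2 - δ / 2 * ((D : ℝ) ^ 2 * Real.sqrt d)) / (p : ℕ) / Real.sqrt d))) *
                Real.exp ((κ / 2 - δ / 2 * ((D : ℝ) ^ 2 * Real.sqrt d)) / (p : ℕ) / Real.sqrt d)) ^ d) ^ (p - 1)) ^ (k + 1)))) / (k + 1)!) ≤ ∑ m ∈ (J.image (boxIndex L)), ℓ m) := by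
  classical
  have hL : 0 < L := by omega
  have hγJ : 0 < γA - Jc := by linarith
  have hb0 : 0 ≤ b := zero_le_one.trans hb
  have hγb : 0 ≤ γ * b := mul_nonneg hγ0 hb0
  -- the displayed constants are non-negative (`Λ ≠ ∅`)
  have hV0 : 0 ≤ V := const_nonneg_of_row hΛ (fun e e' => by positivity) hV
  have hM0 : 0 ≤ M := const_nonneg_of_row hΛ (fun e e' => by positivity) hM
  have hV₂0 : 0 ≤ V₂ := const_nonneg_of_row hΛ (fun e e' => (Real.exp_pos _).le) hV₂
  have hM₂0 : 0 ≤ M₂ := const_nonneg_of_row hΛ (fun e e' => mul_nonneg (abs_nonneg _) (Real.exp_pos _).le) hM₂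
  have hKu : 0 ≤ Ku := by
    refine le_trans (mul_nonneg ?_ hγb) hKuI
    have : 0 ≤ V * M / (γA - Jc) := div_nonneg (mul_nonneg hV0 hM0) hγJ.le
    linarith
  have hε₃₁ : 0 ≤ ε₃₁ := by
    refine le_trans ?_ hε₁
    have h1 : 0 ≤ V₂ * M₂ / (γA - Jc) ^ 2 * Real.exp (-(θ / 2 * ((w - v : ℕ) : ℝ))) := by positivity
    have h2 : 0 ≤ Real.exp (-(θ * ((w - v : ℕ) : ℝ))) / (γA - Jc) := div_nonneg (Real.exp_pos _).le hγJ.le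
    linarith
  have hK₀0 : 0 ≤ K₀ := zero_le_one.trans hK₀1
  -- every tessera of `B` meets `I`
  have hBI : ∀ m ∈ J.image (boxIndex L), ∃ x ∈ box L m, x ∈ I := by
    intro m hm
    obtain ⟨j, hj, rfl⟩ := Finset.mem_image.mp hm
    exact ⟨j, mem_box_boxIndex hL j, hJI hj⟩
  -- the Euclidean weight feeds n08-w5's rows
  have hd0 : ∀ e : B1Eq324BenfattoLemma.Site d, (fun x y : B1Eq324BenfattoLemma.Site d => Real.sqrt (∑ j, (((x j : ℝ) - (y j : ℝ))) ^ 2)) e e = 0 := l2_self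
  have hdsymm : ∀ e e' : B1Eq324BenfattoLemma.Site d, (fun x y : B1Eq324BenfattoLemma.Site d => Real.sqrt (∑ j, (((x j : ℝ) - (y j : ℝ))) ^ 2)) e e' =
      (fun x y : B1Eq324BenfattoLemma.Site d => Real.sqrt (∑ j, (((x j : ℝ) - (y j : ℝ))) ^ 2)) e' e := l2_comm
  have hdtri : ∀ e e' e'' : B1Eq324BenfattoLemma.Site d, (fun x y : B1Eq324BenfattoLemma.Site d => Real.sqrt (∑ j, (((x j : ℝ) - (y j : ℝ))) ^ 2)) e e'' ≤
      (fun x y : B1Eq324BenfattoLemma.Site d => Real.sqrt (∑ j, (((x j : ℝ) - (y j : ℝ))) ^ 2)) e e' +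
      (fun x y : B1Eq324BenfattoLemma.Site d => Real.sqrt (∑ j, (((x j : ℝ) - (y j : ℝ))) ^ 2)) e' e'' := fun e e' e'' => l2_triangle e e' e''
  have hl2 : ∀ x y : B1Eq324BenfattoLemma.Site d, Real.sqrt (∑ j, (((x j : ℝ) - (y j : ℝ))) ^ 2) ≤
      (fun x y : B1Eq324BenfattoLemma.Site d => Real.sqrt (∑ j, (((x j : ℝ) - (y j : ℝ))) ^ 2)) x y := fun x y => le_rfl
  -- rows (a)–(f)
  have huI : ∀ ξ ∈ smallFieldOn (corridors L w (J.image (boxIndex L)) : Set (B1Eq324BenfattoLemma.Site d)) I (γ * b),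
      ∀ y ∈ I, |condMean K (corridors L w (J.image (boxIndex L))) ξ y| ≤ Ku := fun ξ hξ y hy =>
    (abs_condMean_le_on_region hK hAs hγA0 hγA hd0 hdsymm hdtri hJc hθ.le hJcγ hl2 hV hM hγb hΓΛ hV0 hM0 ξ hξ y hy).trans hKuI
  have hKR : ∀ m ∈ (J.image (boxIndex L)), ∀ x y, |Kb m x y| ≤ K₀ := fun m hm x y =>
    (abs_partKernel_le hBΛ hKb hAs hγA0 hγA hd0 hdsymm hdtri hJc hθ.le hJcγ hl2 m hm x y).trans hK₀
  have hKrR : ∀ x y, |K x y| ≤ K₀ := fun x y =>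
    (abs_kernel_le hK hAs hγA0 hγA hd0 hdsymm hdtri hJc hθ.le hJcγ hl2 x y).trans hK₀
  have hKdec : ∀ x y : B1Eq324BenfattoLemma.Site d, |K x y| ≤ K₀ * Real.exp (-(θ / Real.sqrt d * ∑ jj, |((x jj : ℝ) - (y jj : ℝ))|)) :=
    fun x y => (abs_kernel_le_exp_l1 hK hAs hγA0 hγA hd0 hdsymm hdtri hJc hθ.le hJcγ hl2 x y).trans
      (mul_le_mul_of_nonneg_right hK₀ (Real.exp_pos _).le)
  have hdec : ∀ m ∈ (J.image (boxIndex L)), ∀ x y : B1Eq324BenfattoLemma.Site d,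
      |Kb m x y| ≤ K₀ * Real.exp (-(θ / Real.sqrt d * ∑ jj, |((x jj : ℝ) - (y jj : ℝ))|)) := fun m hm x y =>
    (abs_partKernel_le_exp_l1 hBΛ hKb hAs hγA0 hγA hd0 hdsymm hdtri hJc hθ.le hJcγ hl2 m hm x y).trans
      (mul_le_mul_of_nonneg_right hK₀ (Real.exp_pos _).le)
  have huε : ∀ m ∈ (J.image (boxIndex L)), ∀ ξ ∈ smallFieldOn (corridors L w (J.image (boxIndex L)) : Set (B1Eq324BenfattoLemma.Site d)) I (γ * b),
      ∀ x ∈ shrink L m (w + (w - v)), |condMean K (corridors L w (J.image (boxIndex L))) ξ x| ≤ ε₃₁ :=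
    abs_condMean_le_deep_of_le hK hL hBΛ hAs hγA0 hγA hd0 hdsymm hdtri hJc hθ.le hJcγ hl2 hM₂ hV₄ hγb hΓΛ hBI hε₂
  have hKε : ∀ m ∈ (J.image (boxIndex L)), ∀ x ∈ shrink L m (w + (w - v)), ∀ y, |Kb m x y - K x y| ≤ ε₃₁ :=
    abs_partKernel_sub_kernel_le_of_le hK hBΛ hKb hAs hγA0 hγA hd0 hdsymm hdtri hJc hθ.le hJcγ hl2 hV₂ hM₂ hε₁
  have hvar : ∀ m ∈ (J.image (boxIndex L)), ∀ x ∈ shrink L m w, Kb m x x ≤ 1 / 2 :=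
    partKernel_self_le_half hBΛ hKb hAs hγA0 hγA hhalf
  have hm : ∀ m ∈ (J.image (boxIndex L)), ∀ ξ ∈ smallFieldOn (corridors L w (J.image (boxIndex L)) : Set (B1Eq324BenfattoLemma.Site d)) I (γ * b),
      ∀ x ∈ shrink L m w, |condMean K (corridors L w (J.image (boxIndex L))) ξ x| ≤ 1 / 2 * b * (1 + distToRegion I x) :=
    abs_condMean_le_half_profile_on_shrink hK hL hBΛ hAs hγA0 hγA hd0 hdsymm hdtri hJc hθ.le hJcγ hl2 hV hM hγb hΓΛ hb0 hsmallγ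
  -- the step
  obtain ⟨ℓ, Err, hbox, hE, hErr⟩ := exists_lower_step hK hAs hγA0 hγA hΓΛ hBΛ hKb hκ hJ hJI hAc0 hA hL2 hv hb hγ1 hsmall hKu hKuK hK₀1 hε₃₁
    huI hKR hKrR hKdec hdec huε hKε hvar hm hδ hδle hres t (s := s) (D := D)
  refine ⟨ℓ, hbox, ?_⟩
  have hsum : ∑ m ∈ (J.image (boxIndex L)), Err m = _ := Finset.sum_congr rfl fun m _ => hErr m
  rw [hsum] at hE
  exact hE

end Standard

end Literature.MathematicalPhysics.QuantumFieldTheory.Balaban1983to89.B1Eq324BenfattoKernelSect5ClassLowerStep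

end
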